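import Mathlib.RepresentationTheory.Irreducible
import Mathlib.LinearAlgebra.Matrix.GeneralLinearGroup.Defs
import Mathlib.LinearAlgebra.StdBasis
import Summits.Langlands.Langlands.Theorems.PhantomRMYoshidaPhantomRMTransportFrobenius

/-!
# Route `PhantomRMYoshida`, support item `PhantomRMTransport` (stmt-Langlands-13641): descent of a
# Frobenius-fixed common eigenvector

Helper for the transport lemma `Summit.Langlands.Langlands.Theses.PhantomRMYoshida.PhantomRMTransport`
(the step "irreducibility of `ρ̄` over `𝔽_p` forbids a `Γ`-stable line of `ρ̄ ⊗ k` defined over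
`𝔽_{p²}`"): let `ρ : Γ → GL₄(𝔽_p)` be irreducible on `𝔽_p⁴` and `w₀ ∈ k⁴` a non-zero common
eigenvector of the matrices `ρ(g)` (viewed in `k`) which is fixed by `F²`, `F` the coordinatewise
Frobenius.  Then the vectors `u_c = c • w₀ + c^p • F w₀` for `c` in the `F²`-fixed subfield
`C = {c | c^{p²} = c}` are `F`-fixed, i.e. come from `𝔽_p⁴`, they are permuted up to the index by
the `ρ(g)` (`ρ(g) u_c = u_{cχ(g)}`), not all zero (test `c = 1` and `c = λ` with `λ ∈ C`,
`λ^p ≠ λ`), and they span a `k`-space of dimension `≤ 2`; their preimages span a non-zero proper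
`ρ(Γ)`-stable subspace of `𝔽_p⁴` — a contradiction (`false_of_fixed_common_eigenvector`).
-/

set_option linter.dupNamespace false
set_option autoImplicit false

namespace Summit.Langlands.Langlands.Theorems.PhantomRMTransport

open Matrix Module

universe u v

variable {p : ℕ} [Fact p.Prime] {k : Type u} [Field k] [CharP k p]

omit [CharP k p] in
/-- Pushing a vector of `𝔽_p⁴` to `k⁴` commutes with matrices. [folklore] -/
theorem ringHom_comp_mulVec (ι : ZMod p →+* k) {n : Type*} [Fintype n] (M : Matrix n n (ZMod p))
    (x : n → ZMod p) : ι ∘ (M *ᵥ x) = M.map ι *ᵥ (ι ∘ x) :=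
  funext (RingHom.map_mulVec ι M x)

/-- **No `F²`-rational stable line.** See the module docstring. [folklore] -/
theorem false_of_fixed_common_eigenvector (ι : ZMod p →+* k) {Γ : Type v} [Monoid Γ]
    (ρ : Γ →* GL (Fin 4) (ZMod p))
    (hirred : Representation.IsIrreducible
      ((Representation.ofDistribMulAction (ZMod p) (GL (Fin 4) (ZMod p)) (Fin 4 → ZMod p)).comp ρ))
    {lam : k} (hlam : (lam ^ p) ^ p = lam) (hlamne : lam ^ p ≠ lam)
    {w₀ : Fin 4 → k} (hw₀ : w₀ ≠ 0) (hfix : frobenius k p ∘ (frobenius k p ∘ w₀) = w₀)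
    (heig : ∀ g, ∃ χ : k, ((ρ g : GL (Fin 4) (ZMod p)) : Matrix (Fin 4) (Fin 4) (ZMod p)).map ι *ᵥ w₀ =
      χ • w₀) :
    False := by
  classical
  set R : Γ → Matrix (Fin 4) (Fin 4) k :=
    fun g => ((ρ g : GL (Fin 4) (ZMod p)) : Matrix (Fin 4) (Fin 4) (ZMod p)).map ι with hR
  have hRf : ∀ g (x : Fin 4 → k), frobenius k p ∘ (R g *ᵥ x) = R g *ᵥ (frobenius k p ∘ x) :=
    fun g x => by rw [frobenius_comp_mulVec, hR, map_frobenius_map_ringHom]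
  -- the `F²`-fixed scalars and the vectors `u c`
  let C : Set k := {c | (c ^ p) ^ p = c}
  let u : k → Fin 4 → k := fun c => c • w₀ + (c ^ p) • (frobenius k p ∘ w₀)
  have hu_f : ∀ c ∈ C, frobenius k p ∘ u c = u c := by
    intro c hc
    change (c ^ p) ^ p = c at hc
    change frobenius k p ∘ (c • w₀ + c ^ p • (frobenius k p ∘ w₀)) =
      c • w₀ + c ^ p • (frobenius k p ∘ w₀)
    rw [frobenius_comp_add, frobenius_comp_smul, frobenius_comp_smul, hfix, hc, add_comm]
  -- eigenvalues lie in `C`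
  have hχC : ∀ g (χ : k), R g *ᵥ w₀ = χ • w₀ → χ ∈ C := by
    intro g χ hχ
    have h1 : frobenius k p ∘ (frobenius k p ∘ (R g *ᵥ w₀)) = R g *ᵥ w₀ := by rw [hRf, hRf, hfix]
    rw [hχ, frobenius_comp_smul, frobenius_comp_smul, hfix] at h1
    have h2 : ((χ ^ p) ^ p - χ) • w₀ = 0 := by rw [sub_smul, h1, sub_self]
    exact sub_eq_zero.1 ((smul_eq_zero.1 h2).resolve_right hw₀)
  -- `R g` permutes the `u c` up to the index
  have hRu : ∀ g, ∀ c ∈ C, ∃ c' ∈ C, R g *ᵥ u c = u c' := by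
    intro g c hc
    obtain ⟨χ, hχ⟩ := heig g
    have hχ' : R g *ᵥ w₀ = χ • w₀ := hχ
    refine ⟨c * χ, ?_, ?_⟩
    · change ((c * χ) ^ p) ^ p = c * χ
      rw [mul_pow, mul_pow, hχC g χ hχ']
      exact congrArg (· * χ) hc
    · change R g *ᵥ (c • w₀ + c ^ p • (frobenius k p ∘ w₀)) =
        (c * χ) • w₀ + (c * χ) ^ p • (frobenius k p ∘ w₀)
      rw [Matrix.mulVec_add, Matrix.mulVec_smul, Matrix.mulVec_smul, ← hRf, hχ', frobenius_comp_smul,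
        smul_smul, smul_smul, mul_pow]
  -- the `k`-span `U` of the `u c` has dimension `≤ 2`
  let U : Submodule k (Fin 4 → k) := Submodule.span k (u '' C)
  have hUle : U ≤ Submodule.span k
      (({w₀, frobenius k p ∘ w₀} : Finset (Fin 4 → k)) : Set (Fin 4 → k)) := by
    refine Submodule.span_le.2 ?_
    rintro _ ⟨c, -, rfl⟩
    simp only [Finset.coe_insert, Finset.coe_singleton]
    exact Submodule.add_mem _ (Submodule.smul_mem _ _ (Submodule.subset_span (Set.mem_insert _ _)))
      (Submodule.smul_mem _ _ (Submodule.subset_span (Set.mem_insert_of_mem _ rfl)))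
  have hfinU : finrank k U ≤ 2 :=
    (Submodule.finrank_mono hUle).trans ((finrank_span_finset_le_card _).trans Finset.card_le_two)
  -- descend the generators to `𝔽_p⁴`
  have hu' : ∀ c ∈ C, ∃ x : Fin 4 → ZMod p, u c = ι ∘ x := fun c hc =>
    exists_eq_ringHom_comp ι (u c) (hu_f c hc)
  choose! u' hu' using hu'
  have hι_inj : Function.Injective fun x : Fin 4 → ZMod p => ι ∘ x := fun x y h =>
    funext fun i => ι.injective (congrFun h i)
  let U' : Submodule (ZMod p) (Fin 4 → ZMod p) := Submodule.span (ZMod p) (u' '' C)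
  -- `U'` is stable under `ρ`
  have hstab : ∀ g, ∀ x ∈ U',
      ((ρ g : GL (Fin 4) (ZMod p)) : Matrix (Fin 4) (Fin 4) (ZMod p)) *ᵥ x ∈ U' := by
    intro g x hx
    induction hx using Submodule.span_induction with
    | mem x hx =>
      obtain ⟨c, hc, rfl⟩ := hx
      obtain ⟨c', hc', hcc'⟩ := hRu g c hc
      have h1 : ((ρ g : GL (Fin 4) (ZMod p)) : Matrix (Fin 4) (Fin 4) (ZMod p)) *ᵥ u' c = u' c' := by
        apply hι_inj
        change ι ∘ (_ *ᵥ u' c) = ι ∘ u' c'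
        rw [ringHom_comp_mulVec, ← hu' c hc, ← hu' c' hc']
        exact hcc'
      rw [h1]
      exact Submodule.subset_span ⟨c', hc', rfl⟩
    | zero => rw [Matrix.mulVec_zero]; exact Submodule.zero_mem _
    | add x y _ _ hx hy => rw [Matrix.mulVec_add]; exact Submodule.add_mem _ hx hy
    | smul r x _ hx => rw [Matrix.mulVec_smul]; exact Submodule.smul_mem _ _ hx
  -- `x ↦ ι ∘ x` maps `U'` into `U`
  have hT : ∀ x ∈ U', ι ∘ x ∈ U := by
    intro x hx
    induction hx using Submodule.span_induction with
    | mem x hx =>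
      obtain ⟨c, hc, rfl⟩ := hx
      rw [← hu' c hc]
      exact Submodule.subset_span ⟨c, hc, rfl⟩
    | zero =>
      have : ι ∘ (0 : Fin 4 → ZMod p) = 0 := funext fun i => by simp
      rw [this]; exact Submodule.zero_mem _
    | add x y _ _ hx hy =>
      have : ι ∘ (x + y) = ι ∘ x + ι ∘ y := funext fun i => by simp
      rw [this]; exact Submodule.add_mem _ hx hy
    | smul r x _ hx =>
      have : ι ∘ (r • x) = ι r • (ι ∘ x) := funext fun i => by simp
      rw [this]; exact Submodule.smul_mem _ _ hx
  -- the subrepresentation `U'` is `⊥` or `⊤`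
  let N : Subrepresentation
      ((Representation.ofDistribMulAction (ZMod p) (GL (Fin 4) (ZMod p)) (Fin 4 → ZMod p)).comp ρ) :=
    ⟨U', fun g x hx => hstab g x hx⟩
  haveI := hirred
  rcases eq_bot_or_eq_top N with hN | hN
  · -- `U' = ⊥`: but some `u c ≠ 0`
    have hU'bot : U' = ⊥ := congrArg Subrepresentation.toSubmodule hN
    have h1C : (1 : k) ∈ C := by change ((1 : k) ^ p) ^ p = 1; rw [one_pow, one_pow]
    have hzero : ∀ c ∈ C, u c = 0 := by
      intro c hc
      have hmem : u' c ∈ U' := Submodule.subset_span ⟨c, hc, rfl⟩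
      rw [hU'bot, Submodule.mem_bot] at hmem
      rw [hu' c hc, hmem]
      funext i; simp
    have h1 := hzero 1 h1C
    have h2 := hzero lam hlam
    change (1 : k) • w₀ + (1 : k) ^ p • (frobenius k p ∘ w₀) = 0 at h1
    change lam • w₀ + lam ^ p • (frobenius k p ∘ w₀) = 0 at h2
    rw [one_pow, one_smul, one_smul] at h1
    have hfw : frobenius k p ∘ w₀ = -w₀ := eq_neg_of_add_eq_zero_right h1
    rw [hfw, smul_neg, ← sub_eq_add_neg, ← sub_smul] at h2
    exact hlamne ((sub_eq_zero.1 ((smul_eq_zero.1 h2).resolve_right hw₀)).symm)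
  · -- `U' = ⊤`: then `U = k⁴`, contradicting `dim U ≤ 2`
    have hU'top : U' = ⊤ := congrArg Subrepresentation.toSubmodule hN
    have hUtop : U = ⊤ := by
      rw [eq_top_iff, ← (Pi.basisFun k (Fin 4)).span_eq, Submodule.span_le]
      rintro _ ⟨i, rfl⟩
      have h1 : ι ∘ (Pi.single i (1 : ZMod p)) = Pi.basisFun k (Fin 4) i := by
        funext j
        simp only [Function.comp_apply, Pi.basisFun_apply, Pi.single_apply]
        split_ifs <;> simp
      rw [SetLike.mem_coe, ← h1]
      exact hT _ (by rw [hU'top]; exact Submodule.mem_top)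
    have h4 : finrank k U = 4 := by rw [hUtop, finrank_top, Module.finrank_fin_fun]
    omega

end Summit.Langlands.Langlands.Theorems.PhantomRMTransport
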